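import Summits.HodgeConjecture.HodgeCM.Automorphic.SchwartzGaussian_1

/-! PORT of `HodgeCM/Automorphic/SchwartzGaussian.lean` (HodgeCMPerL run 82) — part 2: continuation of `Summits.HodgeConjecture.HodgeCM.Automorphic.SchwartzGaussian_1` (split at a top-level declaration boundary by port_pkg.py; scope re-opened below; declarations unchanged). -/

-- port_pkg: scope re-opened for this part (file-level context, then the namespace/section stack open at the cut)
noncomputable section
open scoped Real FourierTransform SchwartzMap InnerProductSpace
open Complex MeasureTheory
set_option autoImplicit false
namespace HodgeCM
namespace SchwartzWeil
section Fourier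
variable (V : Type) [NormedAddCommGroup V] [InnerProductSpace ℝ V] [FiniteDimensional ℝ V]
  [MeasurableSpace V] [BorelSpace V]
/-- The unipotent generator `u` of `Heis V ⋊ F⟨σ, u⟩` maps the Gaussian to the Gaussian of width `π - 2πim`. -/
theorem repP_unip_gaussian (m : ℤ) (hm : m ≠ 0) :
    (repP V m hm (SemidirectProduct.inr (FreeGroup.of PsGen.unip)) : 𝓢(V, ℂ) →L[ℂ] 𝓢(V, ℂ))
        (gaussian V) = gaussianC V (π - 2 * π * (m : ℝ) * Complex.I) (re_sub_chirp_pos re_pi_pos m) := by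
  rw [repP_unip_apply]; exact chirpCLM_gaussian V m

end Fourier

/-! ## 5. The Gaussian theta value: an explicit non-degeneracy witness -/

section Theta

variable (V : Type) [NormedAddCommGroup V] [InnerProductSpace ℝ V] [FiniteDimensional ℝ V]
  (L : Submodule ℤ V) [DiscreteTopology L]

/-- (Ported verbatim from the HodgeCMPerL package; no docstring in the source.) -/
theorem summable_gaussian_lattice_real : Summable fun v : L => Real.exp (-π * ‖(v : V)‖ ^ 2) :=
  (PerL34.LatticeTheta.summable_norm_restrict L (gaussian V)).congr fun v => norm_gaussian_apply V (v : V)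

/-- `∑_{v ∈ L} e^{-π‖v‖²} ≥ 1` (the term `v = 0`). -/
theorem one_le_tsum_gaussian_lattice : 1 ≤ ∑' v : L, Real.exp (-π * ‖(v : V)‖ ^ 2) := by
  have h := (summable_gaussian_lattice_real V L).le_tsum (0 : L) (fun _ _ => (Real.exp_pos _).le)
  simpa using h

/-- (Ported verbatim from the HodgeCMPerL package; no docstring in the source.) -/
theorem tsum_gaussian_lattice_pos : 0 < ∑' v : L, Real.exp (-π * ‖(v : V)‖ ^ 2) :=
  one_pos.trans_le (one_le_tsum_gaussian_lattice V L)

variable [MeasurableSpace V] [BorelSpace V] (m : ℤ)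

omit [DiscreteTopology L] in
/-- `Θ_G(1) = ∑_{v ∈ L} e^{-π‖v‖²}`, a real number. -/
theorem thetaH_gaussian_one :
    thetaH V L m (gaussian V) 1 = ((∑' v : L, Real.exp (-π * ‖(v : V)‖ ^ 2) : ℝ) : ℂ) := by
  rw [thetaH_one, Complex.ofReal_tsum]
  exact tsum_congr fun v => gaussian_apply_ofReal V _

/-- **Explicit non-degeneracy**: `Θ_G(1) ≠ 0`. -/
theorem thetaH_gaussian_one_ne_zero : thetaH V L m (gaussian V) 1 ≠ 0 := by
  rw [thetaH_gaussian_one, Complex.ofReal_ne_zero]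
  exact (tsum_gaussian_lattice_pos V L).ne'

/-- (Ported verbatim from the HodgeCMPerL package; no docstring in the source.) -/
theorem one_le_thetaH_gaussian_one_re : 1 ≤ (thetaH V L m (gaussian V) 1).re := by
  rw [thetaH_gaussian_one, Complex.ofReal_re]; exact one_le_tsum_gaussian_lattice V L

/-- The Gaussian witnesses non-degeneracy of the Heisenberg model's kernel at the identity. -/
theorem heisenbergModel_θ_gaussian_ne_zero (Γ : Subgroup Circle) (hΓ : ∀ u ∈ Γ, u ^ m = 1) :
    (heisenbergModel V L m Γ hΓ).θ ⟨gaussian V, Set.mem_univ _⟩ (QuotientGroup.mk 1, QuotientGroup.mk 1) ≠ 0 := by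
  rw [heisenbergModel_θ_mk, inv_one, inv_one, map_one, mul_one]
  exact thetaH_gaussian_one_ne_zero V L m

/-- … and of the two-generator model `Heis V ⋊ F⟨σ,u⟩` over a self-dual lattice. -/
theorem heisenbergPsModel_θ_gaussian_ne_zero [IsZLattice ℝ L] (hm : m ≠ 0)
    (hL : PoissonSummation.dualLattice L = L) (Γ : Subgroup Circle) (hΓ : ∀ u ∈ Γ, u ^ m = 1) :
    (heisenbergPsModel V L m hm hL Γ hΓ).θ ⟨gaussian V, Set.mem_univ _⟩
        (QuotientGroup.mk 1, QuotientGroup.mk 1) ≠ 0 := by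
  have h := heisenbergPsModel_θ_mk_inl V L m hm hL Γ hΓ (gaussian V) 1 1
  rw [map_one] at h
  rw [h]
  exact heisenbergModel_θ_gaussian_ne_zero V L m Γ hΓ

end Theta

end SchwartzWeil
end HodgeCM

end
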